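import Summits.CriticalPhenomena.SAWScalingLimit.Theorems.SAWLoopFugacityFlowIsingBoundaryRatioWindowRectDefs
import Literature.Probability.LatticeModels.DiscreteExtremalLengthExternalArcs
import HarnessLib

/-!
# The resistance bound for the window rectangle (definitions, line `fk-anchor-transfer`, rev 8)
(crux `SAWLoopFugacityFlow.IsingBoundaryRatio`, stmt-CriticalPhenomena-10650)

A small definitions module next to `…IsingBoundaryRatioWindowRectDefs.lean` (imported, NOT modified) naming
the one analytic TARGET through which both CDH16 instances of the RSW residual are obtained:

* `WindowExtResistanceBound` — for the chordal chart `φ` there is `C` such that for every presentation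
  `IsWindowRect … r₁ r₂ r₁' r₂' Λ E d₀ n` of a lattice chart window (all small `δ`), the resistance of the
  completed network `Ω̄` between the EXTERNAL arcs of the two rough sides
  (`DiscreteRect.extResistance E d₀ n 0 2`, `Literature/…/DiscreteExtremalLengthExternalArcs.lean`) is at most
  `C / log (r₂'/r₁')` — the discrete counterpart of the extremal distance `π / log (r₂'/r₁')` between the
  two ends of the half-annulus `{r₁' < |w| < r₂'} ∩ ℍ`, with `C` INDEPENDENT of the modulus. Route of the
  eventual proof (Chelkak 2016, Prop. 6.2 (i), the elementary direction): by Duffin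
  (`extremalLength_eq_effectiveResistance`) it suffices to bound `dist_W(arcs)² ≤ (C / log) · Σ_e W_e²` for
  every edge metric `W`; spread `W_e / δ` over the block of lattice cells around `e` to get a Borel metric `ĝ`
  on `D` of area `≲ Σ W_e²`; for almost every `r ∈ (r₁', r₂')` the chart semicircle `φ({|w| = r})`, followed
  from its top `φ(ir)` (a bulk vertex of `E`, `IsWindowRect.bulk_mem`) to either side, runs through full cells
  whose edges lie in `E` (`IsWindowRect.closed`) until the first cell meeting `∂D`, where a boundary vertex of
  `E` of inner chart radius — on arc `0`, resp. `2`, by `IsWindowRect.arc0_sup/arc2_sup` — and its external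
  edge are reached; the edges of the cells met carry a lattice path between the two external arcs of
  `W`-length `≲ ∫ ĝ |dz|` along the semicircle (each cell met is left through the surrounding square annulus,
  of width `δ`); averaging over `r` against `dr / r`, the change of variables `z = φ(w)` on the log-polar
  rectangle and Cauchy–Schwarz (as in `extremalDistance_rectangle`, `area_pullbackMetric`) give the claim.
* From it: `ℓ_Ω[(sides)] ≤ ℓ_Ω̄[(sides)] ≤ C / log` feeds CDH16 Thm 1.1 (i) (side-to-side crossings, free
  measure), and `ℓ_Ω[(rims)] ≥ ℓ_Ω̄[(rims)] - 4(2√2−1) ≥ c₀ log (r₂'/r₁') / C - 4(2√2−1) ≥ 1` for large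
  modulus (CDH16 §3.3 sandwich and self-duality, named facts `discreteEL_ext_sandwich`,
  `discreteEL_ext_selfDual`) feeds Thm 1.1 (ii) (rim-to-rim crossings, wired measure).

The proposition is a TARGET of the line, not a cited fact; nothing is asserted.
-/

noncomputable section

open scoped Classical Topology
open Filter Set Metric SimpleGraph
open Literature.Probability.LatticeModels Literature.Probability.RandomPlanarGeometry
open Literature.Probability.Percolation (BondConfig)
open UpperHalfPlane (upperHalfPlaneSet)

namespace Summit.CriticalPhenomena.SAWScalingLimit.Theorems.IsingBoundaryRatio

/-- **Resistance bound for the window rectangle** (TARGET; see the module docstring): for the chordal chart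
`φ` there is `C > 0` such that for every `M > 1`, `ε > 0` there is `ρ₀ > 0` with: for every scale `ρ < ρ₀`,
all radii `ρ < r₁ < r₁' < r₂' < r₂ < Mρ`, all small `δ`, every finite volume `Λ` agreeing locally with `Ω_δ`
in `B(a, ε)` and containing the chart disc of radius `Mρ`, and every presentation
`IsWindowRect D φ M ε δ ρ r₁ r₂ r₁' r₂' Λ E d₀ n`, the external-arc resistance satisfies
`ℓ_Ω̄[(arc 0)_ext, (arc 2)_ext] ≤ C / log (r₂'/r₁')`. -/
def WindowExtResistanceBound : Prop :=
  ∀ (D : DobrushinDomain) (φ : ConformalEquiv upperHalfPlaneSet D.carrier),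
    D.IsChordalUniformizing φ → ∃ C : ℝ, 0 < C ∧ ∀ (M : ℝ), 1 < M → ∀ (ε : ℝ), 0 < ε →
      ∃ ρ₀ : ℝ, 0 < ρ₀ ∧ ∀ (ρ : ℝ), 0 < ρ → ρ < ρ₀ → ∀ (r₁ r₁' r₂' r₂ : ℝ),
        ρ < r₁ → r₁ < r₁' → r₁' < r₂' → r₂' < r₂ → r₂ < M * ρ →
        ∀ᶠ δ in 𝓝[>] (0 : ℝ), ∀ (Λ : Finset (Site 2)),
          LocalAgreement D.carrier (D.pt 0) ε δ (discreteDomainGraph D.carrier δ) Λ →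
          (∀ x ∈ meshDomain D.carrier δ, ‖φ.symm (meshPoint δ x)‖ < M * ρ → x ∈ Λ) →
          ∀ (E : Finset (Sym2 (Site 2))) (d₀ : Site 2 × Fin 4) (n : Fin 4 → ℕ),
            IsWindowRect D φ M ε δ ρ r₁ r₂ r₁' r₂' Λ E d₀ n →
              DiscreteRect.extResistance E d₀ n 0 2 ≤ ENNReal.ofReal (C / Real.log (r₂' / r₁'))

/-- The all-moduli rim bound implies its large-modulus form (with `M₀ = 2`, discarding the volume
hypothesis); registered sub-goal of stmt-CriticalPhenomena-10650. [folklore] -/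
theorem halfAnnulusRimCrossingBoundLarge_of_bound : HalfAnnulusRimCrossingBound → HalfAnnulusRimCrossingBoundLarge :=
  fun h D φ hφ => ⟨2, one_lt_two, fun M hM => by
    obtain ⟨c, hc, h'⟩ := h D φ hφ M (one_lt_two.trans_le hM)
    refine ⟨c, hc, fun ε hε => ?_⟩
    obtain ⟨ρ₀, hρ₀, h''⟩ := h' ε hε
    refine ⟨ρ₀, hρ₀, fun ρ hρ hρlt => ?_⟩
    filter_upwards [h'' ρ hρ hρlt] with δ hδ Λ hLA _
    exact hδ Λ hLA⟩

end Summit.CriticalPhenomena.SAWScalingLimit.Theorems.IsingBoundaryRatio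

end
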